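import Literature.NumberTheory.EllipticCurves.Smith2016.CongruentNumberGenusDeterminantConsequences
import HarnessLib

/-!
# Smith 2016, Thm. 2.2 row `1` for TWO prime factors, PROVED: for distinct odd primes `p ≡ q (mod 8)` (i.e. `pq ≡ 1 (mod 8)`), `ℒ₁(pq) ≡ det M₁ (mod 2)`; hence, unconditionally, `rank E_{pq}(ℚ) = 0 ∧ Ш(E_{pq})[2^∞] = 0 ⟺ Σ∏g(dᵢ)` odd `⟺ p ≡ q ≡ 3 (mod 8)`

Topic `NumberTheory/EllipticCurves`, namespace `Literature.NumberTheory.EllipticCurves.Smith2016`.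
A pure proof file (theorems only).  It DISCHARGES the named fact `smith_thm22_rowOne` (Smith 2016, Thm. 2.2
row `1`, `CongruentNumberGenusDeterminantRowOne`) in the case of two prime factors, so that the consequences of
`CongruentNumberGenusDeterminantConsequences` — Tian–Yuan–Zhang's (journal) Theorem 1.2 = Smith's Thm. 4.1 /
Cor. 4.2 on `n ≡ 1 (mod 8)` — become UNCONDITIONAL tree theorems for `n = pq`.

## The computation (Smith's `M₁ = (A + Aᵀ, Aᵀ; A, D_z)` and `Q(A, z) = (A | z)` at `k = 2`)

For distinct odd primes `p, q` put `a = (q/p)₊`, `b = (p/q)₊`, `z₀ = (2/p)₊`, `z₁ = (2/q)₊` (elements of `𝔽₂`).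
Then `A = (a a; b b)` (diagonal = row sums), so
`M₁ = ((0, a+b; a+b, 0), (a b; a b); (a a; b b), (z₀ 0; 0 z₁))` (`smithMatrixOne_pair_eq`) and
`(A with column 1 := z) = (a z₀; b z₁)` (`updateCol_pair_eq`).  When `p ≡ q (mod 8)` (`z₀ = z₁ =: z`) a case
check over `(a, b, z) ∈ 𝔽₂³` gives `det M₁ = det (a z; b z) = z(a + b)` (`det_smithMatrixOne_pair_eq_det_updateCol`).
By the sibling files: `g(pq)` odd `⟺ det (a z; b z) = 1` (Smith's Table 2 / Rédei–Reichardt,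
`odd_genusClassNumber_genusField_iff_det_updateCol`), and for `p ≡ q ≡ 1 (mod 8)` all of `g(p), g(q), g(pq)`
are even; the only decompositions of `pq` are `{pq}` and `{p, q}`, so `ℒ₁(pq) ≡ g(pq) ≡ det M₁ (mod 2)` in every
case (`smith_thm22_rowOne_pair`, `smith_thm22_rowOne_of_two`).  With quadratic reciprocity `a + b = [p ≡ 3 (4)]`
and `z = [p ≡ ±3 (8)]`, so `det M₁ = 1 ⟺ p ≡ q ≡ 3 (mod 8)`: **for distinct primes `p ≡ q (mod 8)`,
`rank E_{pq}(ℚ) = 0 ∧ Ш(E_{pq}/ℚ)[2^∞] = 0 ⟺ #2Cl(ℚ(√−pq))` odd `⟺ p ≡ 3 (mod 8)`**, unconditionally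
(`rank_zero_and_sha_pair_iff_three_mod_eight`; the `⟸` half is Genocchi's 1855 `p₃q₃`, already a tree theorem
via `det M = 1`; the `⟹` half says that for `p ≡ q ∈ {1, 5, 7} (mod 8)` the curve `E_{pq}` has positive rank
or non-trivial `Ш[2^∞]`).

Cell `bsd-monsky` (prover-B g17).  AI provenance: written by an AI assistant; no human has reviewed it.

## References
* [Smith2016CongruentDensity] A. Smith, arXiv:1603.08479v2, §2 Thm. 2.2, Prop. 2.4 (chunk p0005 L59–L63,
  p0006 L13–L34).
* [TianYuanZhang2017] Asian J. Math. 21 (2017), Thm. 1.2 (journal numbering).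
* [HeathBrown1994SelmerCongruentII] Appendix (Monsky), typescript p. 39 L10–L33; §1 p. 6 (two-prime tables).
* [Feng1996NonCongruent] K. Feng, Acta Arith. 75 (1996), §1 p. 72 (Genocchi 1855: `p₃q₃` non-congruent).
* [IrelandRosen1990] GTM 84, Ch. 5 §1–§2 (quadratic reciprocity and the supplements).
-/

open scoped Classical

open Matrix Finset
open Literature.NumberTheory.EllipticCurves.HeathBrown1994
open Literature.NumberTheory.EllipticCurves.MonskySelmerParity
open Literature.NumberTheory.EllipticCurves.TianYuanZhang2017

namespace Literature.NumberTheory.EllipticCurves.Smith2016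

section TwoPrimes

variable {p q : ℕ}

/-- **Smith's `M₁` for two primes, symbolically**: with `a = (q/p)₊`, `b = (p/q)₊`, `zᵢ = (2/pᵢ)₊`,
`M₁ = ((0, a+b; a+b, 0), (a, b; a, b); (a, a; b, b), (z₀, 0; 0, z₁))` (the diagonal of `A` is the row sum).
[cite: Smith2016CongruentDensity, §2 (chunk p0005 L18–L24) and §2.2 (chunk p0008 L42)] -/
theorem smithMatrixOne_pair_eq (p q : ℕ) :
    Matrix.fromBlocks (legendreMatrix ![p, q] + (legendreMatrix ![p, q])ᵀ) (legendreMatrix ![p, q])ᵀ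
        (legendreMatrix ![p, q]) (legendreDiagonal ![p, q] 2) =
      Matrix.fromBlocks
        !![0, addLegendreSym q p + addLegendreSym p q; addLegendreSym q p + addLegendreSym p q, 0]
        !![addLegendreSym q p, addLegendreSym p q; addLegendreSym q p, addLegendreSym p q]
        !![addLegendreSym q p, addLegendreSym q p; addLegendreSym p q, addLegendreSym p q]
        !![addLegendreSym 2 p, 0; 0, addLegendreSym 2 q] := by
  have hdiag0 : legendreMatrix ![p, q] 0 0 = addLegendreSym q p := by
    simp [legendreMatrix, Finset.sum_erase_eq_sub, Fin.sum_univ_two]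
  have hdiag1 : legendreMatrix ![p, q] 1 1 = addLegendreSym p q := by
    simp [legendreMatrix, Finset.sum_erase_eq_sub, Fin.sum_univ_two]
  have h01 : legendreMatrix ![p, q] 0 1 = addLegendreSym q p := by simp [legendreMatrix]
  have h10 : legendreMatrix ![p, q] 1 0 = addLegendreSym p q := by simp [legendreMatrix]
  ext i j
  rcases i with i | i <;> rcases j with j | j <;> fin_cases i <;> fin_cases j <;>
    simp [Matrix.fromBlocks, legendreDiagonal, Matrix.diagonal, hdiag0, hdiag1, h01, h10,
      CharTwo.add_self_eq_zero, add_comm]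

/-- **Smith's `Q(A, z) = (A | z)` for two primes**: `(A with column 1 := z) = (a, z₀; b, z₁)`.
[cite: Smith2016CongruentDensity, Prop. 2.4 (chunk p0006 L23–L30)] -/
theorem updateCol_pair_eq (p q : ℕ) :
    (legendreMatrix ![p, q]).updateCol 1 (fun i => addLegendreSym 2 (![p, q] i)) =
      !![addLegendreSym q p, addLegendreSym 2 p; addLegendreSym p q, addLegendreSym 2 q] := by
  have hdiag0 : legendreMatrix ![p, q] 0 0 = addLegendreSym q p := by
    simp [legendreMatrix, Finset.sum_erase_eq_sub, Fin.sum_univ_two]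
  have h10 : legendreMatrix ![p, q] 1 0 = addLegendreSym p q := by simp [legendreMatrix]
  ext i j
  fin_cases i <;> fin_cases j <;> simp [hdiag0, h10]

/-- **`det M₁ = det (A | z)` for two primes `p ≡ q (mod 8)`** (`(2/p)₊ = (2/q)₊`): a check over the eight
values of `(a, b, z) ∈ 𝔽₂³` (`det = z(a + b)` on both sides).
[cite: Smith2016CongruentDensity, Thm. 2.2 / Prop. 2.4 at r = 2 (chunk p0006 L56–L80: the k = 2 case)] -/
theorem det_smithMatrixOne_pair_eq_det_updateCol (hz : addLegendreSym 2 p = addLegendreSym 2 q) :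
    (Matrix.fromBlocks (legendreMatrix ![p, q] + (legendreMatrix ![p, q])ᵀ) (legendreMatrix ![p, q])ᵀ
        (legendreMatrix ![p, q]) (legendreDiagonal ![p, q] 2)).det =
      ((legendreMatrix ![p, q]).updateCol 1 (fun i => addLegendreSym 2 (![p, q] i))).det := by
  rw [smithMatrixOne_pair_eq, updateCol_pair_eq, ← hz]
  generalize addLegendreSym q p = a
  generalize addLegendreSym p q = b
  generalize addLegendreSym 2 p = z
  fin_cases a <;> fin_cases b <;> fin_cases z <;> decide

/-- `(2/p)₊ = (2/q)₊` for odd `p ≡ q (mod 8)`. [cite: IrelandRosen1990, Ch. 5 §1 Prop. 5.1.3 (second supplement)] -/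
theorem addLegendreSym_two_eq_of_mod_eight_eq (hp2 : Odd p) (hq2 : Odd q) (hr : p % 8 = q % 8) :
    addLegendreSym 2 p = addLegendreSym 2 q := by
  rw [addLegendreSym_two_of_odd hp2, addLegendreSym_two_of_odd hq2, hr]

/-- The divisors of `pq` (`p, q` distinct primes) are `1, p, q, pq`. [cite: IrelandRosen1990, Ch. 1 §1 (unique factorisation)] -/
theorem eq_of_dvd_prime_mul_prime (hp : p.Prime) (hq : q.Prime) {d : ℕ} (hd : d ∣ p * q) :
    d = 1 ∨ d = p ∨ d = q ∨ d = p * q := by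
  by_cases hpd : p ∣ d
  · obtain ⟨e, rfl⟩ := hpd
    have he : e ∣ q := Nat.dvd_of_mul_dvd_mul_left hp.pos hd
    rcases (Nat.dvd_prime hq).mp he with rfl | rfl
    · exact Or.inr (Or.inl (mul_one p))
    · exact Or.inr (Or.inr (Or.inr rfl))
  · have hcop : Nat.Coprime p d := (Nat.Prime.coprime_iff_not_dvd hp).mpr hpd
    have hdq : d ∣ q := hcop.symm.dvd_of_dvd_mul_left hd
    rcases (Nat.dvd_prime hq).mp hdq with rfl | rfl
    · exact Or.inl rfl
    · exact Or.inr (Or.inr (Or.inl rfl))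

/-- **`ℒ₁(pq) ≡ g(pq) (mod 2)`** for distinct odd primes `p ≡ q (mod 8)`: if `p ≢ 1 (mod 8)` no proper factor
of `pq` is `≡ 1 (mod 8)` and `ℒ₁(pq) = g(pq)`; if `p ≡ q ≡ 1 (mod 8)` every decomposition of `pq` consists of
`p, q, pq`, whose genus class numbers are all EVEN (`(2/p)₊ = 0`: Smith's Table 2), so both sides vanish.
[cite: Smith2016CongruentDensity, §2 Definition of ℒ and Table 2 (chunk p0005 L26–L44)]
[cite: TianYuanZhang2017, Thm. 1.1 (the first genus sum)] -/
theorem natCast_genusSum₁_pair (hp : p.Prime) (hq : q.Prime) (hne : p ≠ q) (hp2 : p ≠ 2) (hq2 : q ≠ 2)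
    (hr : p % 8 = q % 8) :
    ((genusSum₁ (p * q) (fun d => genusClassNumber (GenusField d)) : ℕ) : ZMod 2) =
      ((genusClassNumber (GenusField (p * q)) : ℕ) : ZMod 2) := by
  have hpq1 : 1 < p * q := Nat.one_lt_mul_iff.mpr ⟨hp.pos, hq.pos, Or.inl hp.one_lt⟩
  by_cases h1 : p % 8 = 1
  · -- all of `g(p), g(q), g(pq)` are even
    have hq1 : q % 8 = 1 := hr ▸ h1
    have hgp : Even (genusClassNumber (GenusField p)) := even_genusClassNumber_genusField_prime hp h1
    have hgq : Even (genusClassNumber (GenusField q)) := even_genusClassNumber_genusField_prime hq hq1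
    have hodd : ∀ i, Odd ((![p, q] : Fin 2 → ℕ) i) := fun i => by
      fin_cases i
      · exact hp.odd_of_ne_two hp2
      · exact hq.odd_of_ne_two hq2
    have hprime : ∀ i, ((![p, q] : Fin 2 → ℕ) i).Prime := fun i => by fin_cases i <;> assumption
    have h4 : (∏ i, (![p, q] : Fin 2 → ℕ) i) % 4 = 1 := by
      have hp4 : p % 4 = 1 := by omega
      have hq4 : q % 4 = 1 := by omega
      rw [Families.prod_vecPair, Nat.mul_mod, hp4, hq4]
    have hgpq : Even (genusClassNumber (GenusField (p * q))) := by
      have h := odd_genusClassNumber_genusField_iff_det_updateCol ![p, q] hprime hodd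
        (Families.injective_vecPair hne) h4 1
      rw [Families.prod_vecPair] at h
      rw [← Nat.not_odd_iff_even, h, updateCol_pair_eq, Matrix.det_fin_two_of,
        addLegendreSym_two_of_odd (hp.odd_of_ne_two hp2), if_pos (Or.inl h1),
        addLegendreSym_two_of_odd (hq.odd_of_ne_two hq2), if_pos (Or.inl hq1)]
      simp
    rw [(ZMod.natCast_eq_zero_iff_even).mpr hgpq, ZMod.natCast_eq_zero_iff_even]
    -- every term of the genus sum is even
    unfold genusSum₁
    refine Finset.even_sum _ fun D hD => ?_
    rw [Finset.mem_filter] at hD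
    have hD' := hD.1
    simp only [decompositions, Finset.mem_filter, Finset.mem_powerset] at hD'
    obtain ⟨hsub, hgt, -, hprod⟩ := hD'
    have hne' : D.Nonempty := by
      rw [Finset.nonempty_iff_ne_empty]; rintro rfl; rw [Finset.prod_empty] at hprod; omega
    obtain ⟨d, hd⟩ := hne'
    have hdvd : d ∣ p * q := Nat.dvd_of_mem_divisors (hsub hd)
    have hd1 : 1 < d := hgt d hd
    have heven : Even (genusClassNumber (GenusField d)) := by
      rcases eq_of_dvd_prime_mul_prime hp hq hdvd with rfl | rfl | rfl | rfl
      · omega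
      · exact hgp
      · exact hgq
      · exact hgpq
    exact even_iff_two_dvd.mpr ((even_iff_two_dvd.mp heven).trans (Finset.dvd_prod_of_mem _ hd))
  · -- no proper factor `≡ 1 (mod 8)`
    rw [genusSum₁_eq_self hpq1 fun d hd hd1 hlt => ?_]
    rcases eq_of_dvd_prime_mul_prime hp hq hd with rfl | rfl | rfl | rfl
    · omega
    · exact h1
    · exact fun h => h1 (hr.trans h)
    · omega

/-- For `m : ℕ` and `x ∈ 𝔽₂`: if `m` is odd exactly when `x = 1`, then `m ≡ x`. [cite: Smith2016CongruentDensity, §2 (chunk p0005 L26–L27: "mod 2")] -/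
theorem natCast_eq_of_odd_iff {m : ℕ} {x : ZMod 2} (h : Odd m ↔ x = 1) : (m : ZMod 2) = x := by
  fin_cases x
  · exact (ZMod.natCast_eq_zero_iff_even).mpr (Nat.not_odd_iff_even.mp fun hm => zero_ne_one (h.mp hm))
  · exact (ZMod.natCast_eq_one_iff_odd).mpr (h.mpr rfl)

/-- **Smith 2016, Thm. 2.2 row `1` HOLDS for two prime factors**: for distinct odd primes `p ≡ q (mod 8)`,
`ℒ₁(pq) ≡ det M₁ (mod 2)`. [cite: Smith2016CongruentDensity, Thm. 2.2 (chunk p0005 L59–L63); Prop. 2.4, the case k = 2 (chunk p0006 L56–L80)] -/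
theorem smith_thm22_rowOne_pair (hp : p.Prime) (hq : q.Prime) (hne : p ≠ q) (hp2 : p ≠ 2) (hq2 : q ≠ 2)
    (hr : p % 8 = q % 8) :
    ((genusSum₁ (p * q) (fun d => genusClassNumber (GenusField d)) : ℕ) : ZMod 2) =
      (Matrix.fromBlocks (legendreMatrix ![p, q] + (legendreMatrix ![p, q])ᵀ) (legendreMatrix ![p, q])ᵀ
        (legendreMatrix ![p, q]) (legendreDiagonal ![p, q] 2)).det := by
  have hodd : ∀ i, Odd ((![p, q] : Fin 2 → ℕ) i) := fun i => by
    fin_cases i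
    · exact hp.odd_of_ne_two hp2
    · exact hq.odd_of_ne_two hq2
  have hprime : ∀ i, ((![p, q] : Fin 2 → ℕ) i).Prime := fun i => by fin_cases i <;> assumption
  have h4 : (∏ i, (![p, q] : Fin 2 → ℕ) i) % 4 = 1 := by
    rw [Families.prod_vecPair]
    have h8 : p % 8 = 1 ∨ p % 8 = 3 ∨ p % 8 = 5 ∨ p % 8 = 7 := by
      have := Nat.odd_iff.mp (hp.odd_of_ne_two hp2); omega
    rcases h8 with h | h | h | h <;>
      · have hq' : q % 8 = p % 8 := hr.symm
        rw [h] at hq'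
        rw [Nat.mul_mod, show p % 4 = p % 8 % 4 by omega, show q % 4 = q % 8 % 4 by omega, h, hq']
  rw [natCast_genusSum₁_pair hp hq hne hp2 hq2 hr,
    det_smithMatrixOne_pair_eq_det_updateCol
      (addLegendreSym_two_eq_of_mod_eight_eq (hp.odd_of_ne_two hp2) (hq.odd_of_ne_two hq2) hr)]
  refine natCast_eq_of_odd_iff ?_
  have h := odd_genusClassNumber_genusField_iff_det_updateCol ![p, q] hprime hodd (Families.injective_vecPair hne) h4 1
  rwa [Families.prod_vecPair] at h

/-- **`smith_thm22_rowOne` restricted to `k = 2` holds** (the fact's own binder shape: `pq ≡ 1 (mod 8)` for odd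
`p, q` means `p ≡ q (mod 8)`). [cite: Smith2016CongruentDensity, Thm. 2.2 (chunk p0005 L59–L63)] -/
theorem smith_thm22_rowOne_of_two (f : Fin 2 → ℕ) (hf : ∀ i, (f i).Prime) (hodd : ∀ i, Odd (f i))
    (hinj : Function.Injective f) (h8 : (∏ i, f i) % 8 = 1) :
    ((genusSum₁ (∏ i, f i) (fun d => genusClassNumber (GenusField d)) : ℕ) : ZMod 2) =
      (Matrix.fromBlocks (legendreMatrix f + (legendreMatrix f)ᵀ) (legendreMatrix f)ᵀ
        (legendreMatrix f) (legendreDiagonal f 2)).det := by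
  have hfe : f = ![f 0, f 1] := by ext i; fin_cases i <;> rfl
  have hprod : ∏ i, f i = f 0 * f 1 := by rw [Fin.prod_univ_two]
  have hne : f 0 ≠ f 1 := fun h => by have := hinj h; exact absurd this (by decide)
  have h02 : f 0 ≠ 2 := ne_two_of_odd f hodd 0
  have h12 : f 1 ≠ 2 := ne_two_of_odd f hodd 1
  have hr : f 0 % 8 = f 1 % 8 := by
    rw [hprod] at h8
    have ho0 := Nat.odd_iff.mp (hodd 0); have ho1 := Nat.odd_iff.mp (hodd 1)
    have : f 0 % 8 = 1 ∨ f 0 % 8 = 3 ∨ f 0 % 8 = 5 ∨ f 0 % 8 = 7 := by omega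
    have : f 1 % 8 = 1 ∨ f 1 % 8 = 3 ∨ f 1 % 8 = 5 ∨ f 1 % 8 = 7 := by omega
    rw [Nat.mul_mod] at h8
    rcases this with h | h | h | h <;> rcases ‹f 0 % 8 = 1 ∨ _› with h' | h' | h' | h' <;>
      simp [h, h'] at h8 ⊢
  rw [hprod, hfe]
  simpa using smith_thm22_rowOne_pair (hf 0) (hf 1) hne h02 h12 hr

/-! ### Unconditional consequences for `n = pq ≡ 1 (mod 8)` -/

/-- **TYZ (journal) Thm. 1.2 / Smith Thm. 4.1–Cor. 4.2 for `n = pq`, UNCONDITIONALLY**: for distinct odd primes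
`p ≡ q (mod 8)`, `rank E_{pq}(ℚ) = 0 ∧ Ш(E_{pq}/ℚ)[2^∞] = 0 ⟺ Σ∏g(dᵢ)` is odd.
[cite: TianYuanZhang2017, Thm. 1.2 (journal numbering)] [cite: Smith2016CongruentDensity, Thm. 1.2, Thm. 2.2] -/
theorem rank_zero_and_sha_pair_iff_odd_genusSum₁ (hp : p.Prime) (hq : q.Prime) (hne : p ≠ q) (hp2 : p ≠ 2)
    (hq2 : q ≠ 2) (hr : p % 8 = q % 8) :
    ((haveI := isElliptic_congruentNumberCurve (mul_ne_zero hp.ne_zero hq.ne_zero);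
        (congruentNumberCurve (p * q)).mordellWeilRank = 0) ∧
      (haveI := isElliptic_congruentNumberCurve (mul_ne_zero hp.ne_zero hq.ne_zero);
        AddCommGroup.primaryComponent (congruentNumberCurve (p * q)).sha 2 = ⊥)) ↔
      Odd (genusSum₁ (p * q) fun d => genusClassNumber (GenusField d)) := by
  have hodd : ∀ i, Odd ((![p, q] : Fin 2 → ℕ) i) := fun i => by
    fin_cases i
    · exact hp.odd_of_ne_two hp2
    · exact hq.odd_of_ne_two hq2
  have hprime : ∀ i, ((![p, q] : Fin 2 → ℕ) i).Prime := fun i => by fin_cases i <;> assumption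
  have h4 : (p * q) % 4 = 1 := by
    have h8 : p % 8 = 1 ∨ p % 8 = 3 ∨ p % 8 = 5 ∨ p % 8 = 7 := by
      have := Nat.odd_iff.mp (hp.odd_of_ne_two hp2); omega
    rcases h8 with h | h | h | h <;>
      · have hq' : q % 8 = p % 8 := hr.symm
        rw [h] at hq'
        rw [Nat.mul_mod, show p % 4 = p % 8 % 4 by omega, show q % 4 = q % 8 % 4 by omega, h, hq']
  rw [← card_selmerGroup_two_eq_four_iff_rank_zero_and_sha (mul_ne_zero hp.ne_zero hq.ne_zero),
    card_selmerGroup_two_eq_four_iff_det_smithMatrixOne' ![p, q] Families.prod_vecPair hprime hodd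
      (Families.injective_vecPair hne) h4,
    ← ZMod.natCast_eq_one_iff_odd, smith_thm22_rowOne_pair hp hq hne hp2 hq2 hr]

/-- **For distinct primes `p ≡ q (mod 8)`: `rank E_{pq}(ℚ) = 0 ∧ Ш(E_{pq}/ℚ)[2^∞] = 0 ⟺ p ≡ 3 (mod 8)`** —
unconditionally (`det M₁ = z(a+b) = [(2/p) = −1]·[p ≡ 3 (4)]` by reciprocity).  The `⟸` half is Genocchi's
`p₃q₃` (1855); the `⟹` half: for `p ≡ q ∈ {1, 5, 7} (mod 8)`, `E_{pq}` has positive rank or `Ш[2^∞] ≠ 0`.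
[cite: Feng1996NonCongruent, §1 p. 72 L1–L2 (Genocchi: p₃q₃)] [cite: HeathBrown1994SelmerCongruentII, §1 typescript p. 6 (two-prime Selmer ranks)]
[cite: SilvermanAEC2009, Thm. X.4.2] -/
theorem rank_zero_and_sha_pair_iff_three_mod_eight (hp : p.Prime) (hq : q.Prime) (hne : p ≠ q)
    (hp2 : p ≠ 2) (hq2 : q ≠ 2) (hr : p % 8 = q % 8) :
    ((haveI := isElliptic_congruentNumberCurve (mul_ne_zero hp.ne_zero hq.ne_zero);
        (congruentNumberCurve (p * q)).mordellWeilRank = 0) ∧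
      (haveI := isElliptic_congruentNumberCurve (mul_ne_zero hp.ne_zero hq.ne_zero);
        AddCommGroup.primaryComponent (congruentNumberCurve (p * q)).sha 2 = ⊥)) ↔ p % 8 = 3 := by
  have hodd : ∀ i, Odd ((![p, q] : Fin 2 → ℕ) i) := fun i => by
    fin_cases i
    · exact hp.odd_of_ne_two hp2
    · exact hq.odd_of_ne_two hq2
  have hprime : ∀ i, ((![p, q] : Fin 2 → ℕ) i).Prime := fun i => by fin_cases i <;> assumption
  have h8 : p % 8 = 1 ∨ p % 8 = 3 ∨ p % 8 = 5 ∨ p % 8 = 7 := by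
    have := Nat.odd_iff.mp (hp.odd_of_ne_two hp2); omega
  have h4 : (p * q) % 4 = 1 := by
    rcases h8 with h | h | h | h <;>
      · have hq' : q % 8 = p % 8 := hr.symm
        rw [h] at hq'
        rw [Nat.mul_mod, show p % 4 = p % 8 % 4 by omega, show q % 4 = q % 8 % 4 by omega, h, hq']
  rw [← card_selmerGroup_two_eq_four_iff_rank_zero_and_sha (mul_ne_zero hp.ne_zero hq.ne_zero),
    card_selmerGroup_two_eq_four_iff_det_smithMatrixOne' ![p, q] Families.prod_vecPair hprime hodd
      (Families.injective_vecPair hne) h4,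
    det_smithMatrixOne_pair_eq_det_updateCol
      (addLegendreSym_two_eq_of_mod_eight_eq (hp.odd_of_ne_two hp2) (hq.odd_of_ne_two hq2) hr),
    updateCol_pair_eq, Matrix.det_fin_two_of]
  -- `a z₁ − z₀ b` with `zᵢ = [pᵢ ≡ ±3 (8)]`, `a + b = [p ≡ q ≡ 3 (4)]` (reciprocity)
  have hpo : Odd p := hp.odd_of_ne_two hp2
  have hqo : Odd q := hq.odd_of_ne_two hq2
  have hgcd : (p : ℤ).gcd q = 1 := by
    rw [Int.gcd_natCast_natCast]; exact (Nat.coprime_primes hp hq).mpr hne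
  have hab : addLegendreSym (q : ℤ) p + addLegendreSym (p : ℤ) q = if p % 4 = 3 then 1 else 0 := by
    by_cases h3 : p % 4 = 3
    · have hq3 : q % 4 = 3 := by omega
      rw [if_pos h3]
      have hrec : jacobiSym (q : ℤ) p = -jacobiSym (p : ℤ) q :=
        jacobiSym.quadratic_reciprocity_three_mod_four hq3 h3
      rcases jacobiSym.eq_one_or_neg_one hgcd with h | h
      · rw [addLegendreSym_of_eq_one h, addLegendreSym_of_eq_neg_one (by rw [hrec, h])]; decide
      · rw [addLegendreSym_of_eq_neg_one h, addLegendreSym_of_eq_one (by rw [hrec, h]; norm_num)]; decide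
    · have hp1 : p % 4 = 1 := by omega
      rw [if_neg h3]
      have hq1 : q % 4 = 1 := by omega
      have hrec : jacobiSym (q : ℤ) p = jacobiSym (p : ℤ) q :=
        jacobiSym.quadratic_reciprocity_one_mod_four hq1 hpo
      rcases jacobiSym.eq_one_or_neg_one hgcd with h | h
      · rw [addLegendreSym_of_eq_one h, addLegendreSym_of_eq_one (by rw [hrec, h])]; decide
      · rw [addLegendreSym_of_eq_neg_one h, addLegendreSym_of_eq_neg_one (by rw [hrec, h])]; decide
  rw [addLegendreSym_two_of_odd hpo, addLegendreSym_two_of_odd hqo, ← hr]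
  have key : ∀ (a b z s : ZMod 2), a + b = s →
      (a * z - z * b = 1 ↔ s = 1 ∧ z = 1) := by decide
  rw [key _ _ _ _ hab]
  rcases h8 with h | h | h | h
  · have hp4 : ¬ p % 4 = 3 := by omega
    simp [h, hp4]
  · have hp4 : p % 4 = 3 := by omega
    simp [h, hp4]
  · have hp4 : ¬ p % 4 = 3 := by omega
    simp [h, hp4]
  · have hp4 : p % 4 = 3 := by omega
    simp [h, hp4]

end TwoPrimes

end Literature.NumberTheory.EllipticCurves.Smith2016
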